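import Summits.HodgeConjecture.HodgeConjecture.Theorems.HodgeAbelianVarieties.Negative.ExtremeCodimensions
import Summits.HodgeConjecture.HodgeConjecture.Theorems.PadicSemiregularLiftHodgeAbelianVarietiesStarSeedsEngine
import Summits.HodgeConjecture.HodgeConjecture.Theorems.AnchorTransportIsoInvariance
import Literature.AlgebraicGeometry.Crystalline.PadicAnchorDefs

/-!
# `AbelianAnchorAssembly` (stmt-HodgeConjecture-14913) — the glue of its foreseen split, over `PadicAnchorDefs`

Route `PadicSemiregularLift`, support item (abelian anchor-class glue node)
`AbelianAnchorAssembly := HodgeLocusPropagation → FormalLiftingFromClassLifting →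
FormalVectorBundlesAlgebraize → HodgeAbelianVarieties`.

This file lands, sorry-free and over the importable vocabulary module
`Literature/AlgebraicGeometry/Crystalline/PadicAnchorDefs.lean` (namespace
`Literature.AlgebraicGeometry.Crystalline.PadicAnchor`, p88153), the COMPOSITION that the dead crux line
`Cruxes/HodgeAbelianVarieties/Lines/inner-form-invariant-seeds.lean` (gen 3 + Glue IV) kernel-checked inside
the Cruxes tree, now in the shape the planner's FORESEEN GLUED SPLIT of the node consumes:

* `abelianAnchorAssembly_of` — the node from its two foreseen typed children, stated with EXACTLY the binders
  of the one-line items the vocabulary module recommends,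
  `AbelianInnerFormAnchors := ∀ A : AbelianVariety ℂ, InnerFormAnchorsFor A` (support, true in print) and
  `AbelianStarSeeds := ∀ p k … (C : CrystallineRealization p k), StarSeedsAt C` (crux, the abelian half of
  the refuted ∀-anchor seed statement P2a), plus the Hodge-model fact `nonempty_hodgeModel` (= route item
  `AnchorTransport.HodgeModels`, stmt-HodgeConjecture-1943); iso-invariance of algebraic classes
  (`AnchorTransport.IsoInvariance`, stmt-1078) is PROVED (`anchorTransport_isoInvariance_proof`) and is
  consumed as a theorem, no longer a hypothesis;
* the two engine-agnostic fallbacks `abelianAnchorAssembly_of_formalSeeds` (`FormalSeedsAt`, P1a idle) and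
  `abelianAnchorAssembly_of_rationalPVHC` (`RationalPVHCAt`, P1a and P3a idle);
* the engine in the structured vocabulary (`StarSeedsFor ⟹ FormalSeedsFor ⟹ RationalPVHCFor`, from the
  landed engine lemmas of `…StarSeedsEngine.lean`, p77718, and the route items P1a/P3a BY NAME);
* the transfer at one anchor in ALL codimensions (`cyclePart`) and the TIGHTNESS of the node at a genuine,
  spanning, tight anchor with cycle descent: there the engine image `RationalPVHCFor` is literally
  `HodgeConjectureFor` for the anchored fibre (`rationalPVHCFor_iff_hodgeConjectureFor`) — the formal content
  of the route's kill criterion (b-A): beyond HC for the anchored abelian varieties, the node's content is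
  exactly the (⋆)-PRESENTABILITY of seeds.

All theorems here are CONDITIONAL on route items / route-posited predicates taken as hypotheses, by design;
nothing asserts a Theses declaration unconditionally. The unconditional logical status of the node (HC ⟹ node,
node ⟺ `HodgeAbelianVarieties` given the engine) is in `PadicSemiregularLiftAbelianAnchorAssembly.lean`.
-/

-- `Summit.HodgeConjecture.HodgeConjecture.…` is the tree's mandated summit/problem namespace (single-problem summit):
-- the duplicated component is by design (CONVENTIONS §1), so the dupNamespace linter is silenced for this file.
set_option linter.dupNamespace false

noncomputable section

open CategoryTheory AlgebraicGeometry
open scoped Isocrystal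
open Literature.AlgebraicGeometry Literature.AlgebraicGeometry.Motives
  Literature.AlgebraicGeometry.HodgeTheory Literature.AlgebraicGeometry.Crystalline
  Literature.AlgebraicGeometry.KTheory
open Literature.AlgebraicGeometry.Crystalline.PadicAnchor

namespace Summit.HodgeConjecture.HodgeConjecture.Theorems.PadicSemiregularLift.AbelianAnchor

open Summit.HodgeConjecture.HodgeConjecture.Theses.PadicSemiregularLift
open Summit.HodgeConjecture.HodgeConjecture.Cruxes.HodgeAbelianVarieties.InnerFormInvariantSeeds

/-! ### Smooth-projectivity of anchored complex varieties -/

-- adapted from Literature/AlgebraicGeometry/Motives/CurveNet.lean (`IsSmoothProjective.of_iso`), which is outside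
-- this file's import cone
/-- Smooth projective varieties of dimension `n` are stable under isomorphism of `k`-schemes. [folklore] -/
theorem isSmoothProjective_of_iso {k : Type} [Field k] {n : ℕ} {Y Z : SchemeOver k} (e : Y ≅ Z)
    (h : IsSmoothProjective n Y) : IsSmoothProjective n Z where
  smoothOfRelativeDimension := by
    rw [show Z.hom = e.inv.left ≫ Y.hom from (Over.w e.inv).symm]
    exact (MorphismProperty.cancel_left_of_respectsIso (@SmoothOfRelativeDimension n) _ _).mpr
      h.smoothOfRelativeDimension
  isProjectiveOver := by
    obtain ⟨M, i, hi⟩ := h.isProjectiveOver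
    refine ⟨M, e.inv ≫ i, ?_⟩
    rw [Over.comp_left]
    infer_instance
  geometricallyIrreducible := by
    rw [show Z.hom = e.inv.left ≫ Y.hom from (Over.w e.inv).symm]
    exact (MorphismProperty.cancel_left_of_respectsIso (@GeometricallyIrreducible) _ _).mpr
      h.geometricallyIrreducible

/-- **Every complex `n`-fold with a p-adic model is smooth projective of dimension `n`**: the generic fibre of a
smooth proper model is (`IsSmoothProperModel.isSmoothProjective_genericFibre`), base change along `ι` preserves
this (`IsSmoothProjective.baseChangeHom_holds`), and `X ≅ Y_K ⊗_ι ℂ` (`PadicModel.iso`). [folklore] -/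
theorem isSmoothProjective_of_padicModel {n : ℕ} {X : SchemeOver ℂ} (M : PadicModel n X) :
    IsSmoothProjective n X :=
  isSmoothProjective_of_iso M.iso.some.symm
    (IsSmoothProjective.baseChangeHom_holds M.ι M.model.isSmoothProjective_genericFibre)

/-! ### The engine in the structured vocabulary: `(⋆)-seeds ⟹ formal seeds ⟹ rational pVHC` -/

section Engine

variable {p : ℕ} [Fact p.Prime] {k : Type} [Field k] [CharP k p] [PerfectRing k p]

/-- **P1a + BEK give formal lifts of (⋆)-bundles with the Hodge condition** on a model satisfying P1a's
hypotheses (`ModelHypotheses`): the landed engine lemma `Engine.liftsFormally_of_hodgeCondition_of_star`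
(p77718) in the structured vocabulary. Conditional on the route crux P1a `FormalLiftingFromClassLifting`
(stmt-HodgeConjecture-13825), taken by name. [cite: BlochEsnaultKerz2014pAdic, Thm. 1.3] -/
theorem liftsFormally_of_star (hP1a : FormalLiftingFromClassLifting)
    (C : CrystallineRealization p k) (hBEK : BlochEsnaultKerzLifting C) {d : ℕ}
    {𝒴 : SchemeOver (WittVector p k)} (h : ModelHypotheses d 𝒴)
    (E₁ : (WittScheme.specialFibre 𝒴).left.Modules) (hE₁ : IsFiniteLocallyFree E₁)
    (hH : C.HodgeCondition 𝒴 E₁) (hstar : ClassLiftsImplyObjectLifts 𝒴 E₁) :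
    WittScheme.LiftsFormally 𝒴 E₁ :=
  Engine.liftsFormally_of_hodgeCondition_of_star hP1a C hBEK h.smoothProper h.projective h.large
    h.torsionFree_structureSheaf h.torsionFree_hodgeOne h.cotangent_free E₁ hE₁ hH hstar

/-- Hence (⋆)-seed classes are formal seed classes: `StarSeedsFor ⟹ FormalSeedsFor` on a model with P1a's
hypotheses (P1a + BEK). [cite: BlochEsnaultKerz2014pAdic, Thm. 1.3] -/
theorem formalSeedsFor_of_starSeedsFor (hP1a : FormalLiftingFromClassLifting)
    (C : CrystallineRealization p k) (hBEK : BlochEsnaultKerzLifting C) {d : ℕ}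
    {𝒴 : SchemeOver (WittVector p k)} (h : ModelHypotheses d 𝒴) (hS : StarSeedsFor C d 𝒴) :
    FormalSeedsFor C d 𝒴 := by
  intro r h1 hrd u hu hfil
  obtain ⟨N, hN, hNu⟩ := hS r h1 hrd u hu hfil
  refine ⟨N, hN, AddSubgroup.closure_mono ?_ hNu⟩
  rintro _ ⟨E, hE, hH, hstar, rfl⟩
  exact ⟨E, liftsFormally_of_star hP1a C hBEK h E hE hH hstar, rfl⟩

/-- **Formal seeds give rational pVHC in the middle degrees** on a smooth proper model (P3a: formal lifts
algebraize; then the Berthelot–Ogus image of `ch` of an algebraic lift is algebraic, and `ℚ`-saturation —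
`Engine.bo_mem_span_of_formalSeedClasses`). Conditional on the route item P3a `FormalVectorBundlesAlgebraize`
(stmt-HodgeConjecture-14106), taken by name. [cite: BlochEsnaultKerz2014pAdic, §1] -/
theorem rationalPVHCFor_of_formalSeedsFor (hP3a : FormalVectorBundlesAlgebraize)
    (C : CrystallineRealization p k) {d : ℕ} {𝒴 : SchemeOver (WittVector p k)}
    (h𝒴 : WittScheme.IsSmoothProperModel d 𝒴) (hF : FormalSeedsFor C d 𝒴) : RationalPVHCFor C d 𝒴 := by
  intro r h1 hrd u hu hfil
  obtain ⟨N, hN, hNu⟩ := hF r h1 hrd u hu hfil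
  exact Engine.bo_mem_span_of_formalSeedClasses hP3a C h𝒴 hN hNu

/-- THE ENGINE in one line: (⋆)-seeds + P1a + BEK + P3a ⟹ rational pVHC in the middle degrees of the model.
[cite: BlochEsnaultKerz2014pAdic, Thm. 1.3] -/
theorem rationalPVHCFor_of_starSeedsFor (hP1a : FormalLiftingFromClassLifting)
    (hP3a : FormalVectorBundlesAlgebraize) (C : CrystallineRealization p k) (hBEK : BlochEsnaultKerzLifting C)
    {d : ℕ} {𝒴 : SchemeOver (WittVector p k)} (h : ModelHypotheses d 𝒴) (hS : StarSeedsFor C d 𝒴) :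
    RationalPVHCFor C d 𝒴 :=
  rationalPVHCFor_of_formalSeedsFor hP3a C h.smoothProper (formalSeedsFor_of_starSeedsFor hP1a C hBEK h hS)

/-- The three seed predicates at a realization `C` are nested: `StarSeedsAt C ⟹ FormalSeedsAt C` (P1a + BEK) …
[cite: BlochEsnaultKerz2014pAdic, Thm. 1.3] -/
theorem formalSeedsAt_of_starSeedsAt [IsAlgClosed k] (hP1a : FormalLiftingFromClassLifting)
    (C : CrystallineRealization p k) (h : StarSeedsAt C) : FormalSeedsAt C :=
  fun hBO hBEK _ _ A₀ hM hsp hss hdiv hlef hLZ =>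
    formalSeedsFor_of_starSeedsFor hP1a C hBEK hM (h hBO hBEK A₀ hM hsp hss hdiv hlef hLZ)

/-- … and `FormalSeedsAt C ⟹ RationalPVHCAt C` (P3a). [cite: BlochEsnaultKerz2014pAdic, §1] -/
theorem rationalPVHCAt_of_formalSeedsAt [IsAlgClosed k] (hP3a : FormalVectorBundlesAlgebraize)
    (C : CrystallineRealization p k) (h : FormalSeedsAt C) : RationalPVHCAt C :=
  fun hBO hBEK _ _ A₀ hM hsp hss hdiv hlef hLZ =>
    rationalPVHCFor_of_formalSeedsFor hP3a C hM.smoothProper (h hBO hBEK A₀ hM hsp hss hdiv hlef hLZ)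

/-- Hence `StarSeedsAt C ⟹ RationalPVHCAt C` (P1a + BEK + P3a). [cite: BlochEsnaultKerz2014pAdic, Thm. 1.3] -/
theorem rationalPVHCAt_of_starSeedsAt [IsAlgClosed k] (hP1a : FormalLiftingFromClassLifting)
    (hP3a : FormalVectorBundlesAlgebraize) (C : CrystallineRealization p k) (h : StarSeedsAt C) :
    RationalPVHCAt C :=
  rationalPVHCAt_of_formalSeedsAt hP3a C (formalSeedsAt_of_starSeedsAt hP1a C h)

end Engine

/-! ### At one anchor: transfer in all codimensions, and tightness in `HodgeConjectureFor` form -/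

section OneAnchor

variable {n : ℕ} {X : SchemeOver ℂ} (D : Anchor n X)

/-- **Transfer at one anchor, ALL codimensions**: genuineness + SPANNING + rational pVHC in the middle degrees
give the cycle part of the Hodge conjecture for the anchored complex variety `X` in every codimension — the
middle ones by `Anchor.middleCyclePart_of_rationalPVHCFor` (vocabulary module), the extreme ones for free on the
smooth projective `X` (`Engine.mem_algebraicClasses_of_extreme`, `isSmoothProjective_of_padicModel`). [folklore] -/
theorem cyclePart (hD : D.IsGenuine) (hS : D.SpansHodge) (hR : RationalPVHCFor D.C n D.𝒴)
    (r : ℕ) (c : complexBetti X (2 * r)) (hc : IsRationalClass c)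
    (hH : IsOfHodgeType n X (2 * r) r r c) : c ∈ algebraicClasses X r := by
  by_cases hext : r = 0 ∨ n ≤ r
  · exact Engine.mem_algebraicClasses_of_extreme (isSmoothProjective_of_padicModel D.toPadicModel) hext c
  · simp only [not_or, not_le] at hext
    exact D.middleCyclePart_of_rationalPVHCFor hD hS hR r (Nat.pos_of_ne_zero hext.1) hext.2 c hc hH

/-- Rational pVHC in the middle degrees at a genuine anchor, from the anchor-quantified fallback statement
`∀ p k … C, RationalPVHCAt C` specialised to the anchor's realization (`Anchor.rationalPVHCFor_of_rationalPVHCAt`).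
[folklore] -/
theorem rationalPVHCFor_of_forall_rationalPVHCAt
    (hR : ∀ (p : ℕ) [Fact p.Prime] (k : Type) [Field k] [CharP k p] [PerfectRing k p] [IsAlgClosed k]
      (C : CrystallineRealization p k), RationalPVHCAt C)
    (hD : D.IsGenuine) : RationalPVHCFor D.C n D.𝒴 :=
  D.rationalPVHCFor_of_rationalPVHCAt (hR D.p D.k D.C) hD

/-- **TIGHTNESS in `HodgeConjectureFor` form** (route kill criterion (b-A), formal half): at a genuine, spanning,
tight (`UHdgAreHodge`) anchor with cycle descent, and granted the Hodge-model fact for `X`, rational pVHC in the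
middle degrees at the anchor — the engine image of the seed statement — is EQUIVALENT to the tree's
`HodgeConjectureFor n X` for the anchored fibre (`Anchor.rationalPVHCFor_iff_middleCyclePart` + the free extreme
codimensions + `hodgeConjectureFor_iff_of_isSmoothProjective`). So at its own anchors the node's weakest usable
content is the crux instance it is meant to prove; what it adds is the (⋆)-presentability of seeds.
[cite: Deligne2000, §1] -/
theorem rationalPVHCFor_iff_hodgeConjectureFor (hM : nonempty_hodgeModel n X) (hD : D.IsGenuine)
    (hS : D.SpansHodge) (hB2 : D.UHdgAreHodge) (hdesc : D.CycleDescent) :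
    RationalPVHCFor D.C n D.𝒴 ↔ HodgeConjectureFor n X := by
  rw [D.rationalPVHCFor_iff_middleCyclePart hD hS hB2 hdesc,
    hodgeConjectureFor_iff_of_isSmoothProjective hM (isSmoothProjective_of_padicModel D.toPadicModel)]
  constructor
  · intro h r c hc hH
    by_cases hext : r = 0 ∨ n ≤ r
    · exact Engine.mem_algebraicClasses_of_extreme (isSmoothProjective_of_padicModel D.toPadicModel) hext c
    · simp only [not_or, not_le] at hext
      exact h r (Nat.pos_of_ne_zero hext.1) hext.2 c hc hH
  · intro h r _ _ c hc hH
    exact h r c hc hH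

end OneAnchor

/-! ### The composition -/

/-- **HC for complex abelian varieties from rational pVHC at inner-form anchors** (the engine-agnostic core of
the composition): `InnerFormAnchorsFor A` puts `A` at a point `t` of a `ℚ̄`-family with global Hodge classes and a
`ℚ̄`-generic point `s` whose fibre carries a genuine spanning supersingular anchor `D`; `cyclePart` gives the
cycle part of HC on that fibre from `RationalPVHCAt D.C`; P2c `HodgeLocusPropagation` (stmt-13954, by name)
carries algebraicity of the global class from `s` to `t`; iso-invariance of algebraic classes
(`anchorTransport_isoInvariance_proof`, PROVED, stmt-1078) moves it across `A.X ≅ 𝒳_t`; the Hodge-model fact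
`nonempty_hodgeModel` discharges the anti-vacuity conjunct of `HodgeConjectureFor`. [cite: Deligne2000, §1] -/
theorem hodgeAbelianVarieties_of_rationalPVHC (h₁ : ∀ A : AbelianVariety ℂ, InnerFormAnchorsFor A)
    (hR : ∀ (p : ℕ) [Fact p.Prime] (k : Type) [Field k] [CharP k p] [PerfectRing k p] [IsAlgClosed k]
      (C : CrystallineRealization p k), RationalPVHCAt C)
    (hP : HodgeLocusPropagation) (hM : ∀ (n : ℕ) (X : SchemeOver ℂ), nonempty_hodgeModel n X) :
    HodgeAbelianVarieties := by
  intro A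
  refine (hodgeConjectureFor_iff_of_isSmoothProjective (hM A.dim A.X)
    (AbelianVariety.isSmoothProjective_holds (A := A))).2 ?_
  intro p c hc hH
  obtain ⟨σ, 𝒳₀, S₀, f₀, t, s, eA, hqp, hirr, hfam, hgen, hext, D, hD, hS⟩ := h₁ A
  obtain ⟨𝔄, h𝔄c, h𝔄rat, h𝔄hodge⟩ := hext p c hc hH
  -- HC (cycle part) on the anchored fibre `𝒳_s`: spanning + rational pVHC + genuineness
  have hs : complexBetti.map (fiberι ((baseChangeHom σ).map f₀) s) (2 * p) 𝔄 ∈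
      algebraicClasses (fiberOver ((baseChangeHom σ).map f₀) s) p :=
    cyclePart D hD hS (rationalPVHCFor_of_forall_rationalPVHCAt D hR hD) p _ h𝔄rat h𝔄hodge
  -- propagate from the `ℚ̄`-generic point `s` to `t` (P2c), then across `A.X ≅ 𝒳_t` (IsoInvariance, proved)
  have ht := hP σ f₀ A.dim p hqp hirr hfam 𝔄 s hgen hs t
  have hA := anchorTransport_isoInvariance_proof eA p _ ht
  rwa [h𝔄c] at hA

/-- **Composition with formal seeds**: inner-form anchors + `FormalSeedsAt` everywhere + P3a + P2c +
`nonempty_hodgeModel` ⟹ HC for complex abelian varieties. [cite: BlochEsnaultKerz2014pAdic, §1] -/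
theorem hodgeAbelianVarieties_of_formalSeeds (h₁ : ∀ A : AbelianVariety ℂ, InnerFormAnchorsFor A)
    (hF : ∀ (p : ℕ) [Fact p.Prime] (k : Type) [Field k] [CharP k p] [PerfectRing k p] [IsAlgClosed k]
      (C : CrystallineRealization p k), FormalSeedsAt C)
    (hP3a : FormalVectorBundlesAlgebraize) (hP : HodgeLocusPropagation)
    (hM : ∀ (n : ℕ) (X : SchemeOver ℂ), nonempty_hodgeModel n X) : HodgeAbelianVarieties :=
  hodgeAbelianVarieties_of_rationalPVHC h₁ (fun p _ k _ _ _ _ C => rationalPVHCAt_of_formalSeedsAt hP3a C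
    (hF p k C)) hP hM

/-- **THE COMPOSITION of the abelian glue node**: `HodgeAbelianVarieties` from inner-form anchors
(`∀ A, InnerFormAnchorsFor A`), (⋆)-seeds at every realization (`∀ p k … C, StarSeedsAt C`), the route's typed
items P1a (stmt-13825), P3a (stmt-14106), P2c (stmt-13954) taken BY NAME, and the fact `nonempty_hodgeModel`.
[cite: BlochEsnaultKerz2014pAdic, Thm. 1.3] -/
theorem hodgeAbelianVarieties_of (h₁ : ∀ A : AbelianVariety ℂ, InnerFormAnchorsFor A)
    (h₂ : ∀ (p : ℕ) [Fact p.Prime] (k : Type) [Field k] [CharP k p] [PerfectRing k p] [IsAlgClosed k]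
      (C : CrystallineRealization p k), StarSeedsAt C)
    (hP1a : FormalLiftingFromClassLifting) (hP3a : FormalVectorBundlesAlgebraize) (hP : HodgeLocusPropagation)
    (hM : ∀ (n : ℕ) (X : SchemeOver ℂ), nonempty_hodgeModel n X) : HodgeAbelianVarieties :=
  hodgeAbelianVarieties_of_rationalPVHC h₁ (fun p _ k _ _ _ _ C => rationalPVHCAt_of_starSeedsAt hP1a hP3a C
    (h₂ p k C)) hP hM

end Summit.HodgeConjecture.HodgeConjecture.Theorems.PadicSemiregularLift.AbelianAnchor

namespace Summit.HodgeConjecture.HodgeConjecture.Theorems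

open Summit.HodgeConjecture.HodgeConjecture.Theses.PadicSemiregularLift

/-- **`AbelianAnchorAssembly` from its foreseen typed children** (the glue of the planner's FORESEEN GLUED SPLIT,
stated with exactly the binders of the recommended one-line items): inner-form anchors
`∀ A : AbelianVariety ℂ, InnerFormAnchorsFor A` (support, true in print: Kisin's inner form at basic points of
hyperspecial integral canonical models + the fixed-part theorem) + (⋆)-seeds on supersingular abelian-scheme
anchors `∀ p k … (C : CrystallineRealization p k), StarSeedsAt C` (crux, open) + the Hodge-model fact
`nonempty_hodgeModel` (route item `AnchorTransport.HodgeModels`, stmt-1943) give the node; its three engine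
antecedents P2c, P1a, P3a are consumed by name inside. CONDITIONAL on the two children and the fact.
[cite: BlochEsnaultKerz2014pAdic, Thm. 1.3] -/
theorem abelianAnchorAssembly_of (h₁ : ∀ A : Literature.AlgebraicGeometry.Motives.AbelianVariety ℂ,
      InnerFormAnchorsFor A)
    (h₂ : ∀ (p : ℕ) [Fact p.Prime] (k : Type) [Field k] [CharP k p] [PerfectRing k p] [IsAlgClosed k]
      (C : Literature.AlgebraicGeometry.Motives.CrystallineRealization p k), StarSeedsAt C)
    (hM : ∀ (n : ℕ) (X : Literature.AlgebraicGeometry.Motives.SchemeOver ℂ),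
      Literature.AlgebraicGeometry.HodgeTheory.nonempty_hodgeModel n X) :
    AbelianAnchorAssembly :=
  fun hP hP1a hP3a => PadicSemiregularLift.AbelianAnchor.hodgeAbelianVarieties_of h₁ h₂ hP1a hP3a hP hM

/-- **Fallback glue no. 1**: the node from inner-form anchors + FORMAL seeds at every realization
(`FormalSeedsAt`: formally liftable modules instead of (⋆)-bundles; P1a is then idle) + `nonempty_hodgeModel`.
[cite: BlochEsnaultKerz2014pAdic, §1] -/
theorem abelianAnchorAssembly_of_formalSeeds
    (h₁ : ∀ A : Literature.AlgebraicGeometry.Motives.AbelianVariety ℂ, InnerFormAnchorsFor A)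
    (hF : ∀ (p : ℕ) [Fact p.Prime] (k : Type) [Field k] [CharP k p] [PerfectRing k p] [IsAlgClosed k]
      (C : Literature.AlgebraicGeometry.Motives.CrystallineRealization p k), FormalSeedsAt C)
    (hM : ∀ (n : ℕ) (X : Literature.AlgebraicGeometry.Motives.SchemeOver ℂ),
      Literature.AlgebraicGeometry.HodgeTheory.nonempty_hodgeModel n X) :
    AbelianAnchorAssembly :=
  fun hP _ hP3a => PadicSemiregularLift.AbelianAnchor.hodgeAbelianVarieties_of_formalSeeds h₁ hF hP3a hP hM

/-- **Fallback glue no. 2** (engine-free): the node from inner-form anchors + rational p-adic variational Hodge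
in the middle degrees at every realization (`RationalPVHCAt`; P1a and P3a are then idle) + `nonempty_hodgeModel`.
[cite: Deligne2000, §1] -/
theorem abelianAnchorAssembly_of_rationalPVHC
    (h₁ : ∀ A : Literature.AlgebraicGeometry.Motives.AbelianVariety ℂ, InnerFormAnchorsFor A)
    (hR : ∀ (p : ℕ) [Fact p.Prime] (k : Type) [Field k] [CharP k p] [PerfectRing k p] [IsAlgClosed k]
      (C : Literature.AlgebraicGeometry.Motives.CrystallineRealization p k), RationalPVHCAt C)
    (hM : ∀ (n : ℕ) (X : Literature.AlgebraicGeometry.Motives.SchemeOver ℂ),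
      Literature.AlgebraicGeometry.HodgeTheory.nonempty_hodgeModel n X) :
    AbelianAnchorAssembly :=
  fun hP _ _ => PadicSemiregularLift.AbelianAnchor.hodgeAbelianVarieties_of_rationalPVHC h₁ hR hP hM

end Summit.HodgeConjecture.HodgeConjecture.Theorems

end
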